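import Summits.HodgeConjecture.HodgeConjecture.Theorems.H413CuspCotClassMap
import Summits.HodgeConjecture.CorCM.Hyp413.A3Liu413FaceTypes
import Literature.RepresentationTheory.Semisimple.EquivariantIrreducibleDecomposition
import HarnessLib

/-!
# FLOOR-0 P4, stub T2′ — the HOLOMORPHIC HALF AT THE PIN: an injective `U(V)(𝔸_{F⁺,f})`-equivariant class map
# `holCotForms (archFactorOf F V) →ₗ[ℂ] (datum413 …).HB τ'`

Cell hodgecm-mathlib (D-0151), FLOOR 0, crux item H413 = stmt-HodgeConjecture-24833; programme P4, line `Cruxes/H413/Lines/P4AdmissibleOccursInH1.lean`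
v2.1, stub `stub_T2_matsushimaHodgeAt` (:191/:236).  Author A-p13 (g21).  `--supports stmt-HodgeConjecture-24833 --as helper`.

`exists_holClassMap_pin` is `StubT2MatsushimaHodgeAt` RESTRICTED TO THE HOLOMORPHIC SUMMAND `holCotForms 𝔞₀ ≤ cohForms 𝔞₀`: for every face, every
`τ'`, there is a `ℂ`-linear `cls : holCotForms (archFactorOf F V) →ₗ[ℂ] (datum413 hDel F V a₀ Φ i).HB τ'`, INJECTIVE and intertwining the finite-adelic
right translation `rightRep F V` with the pin's Hecke action `rhoB τ'`.  Proof: the pin's `HB τ'` IS the HodgeCM tower `Tower … V` at the universe records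
of record (`datum413` ∘ `prop413Data` ∘ `liuDictionaryPin` ∘ `LiuDictionary.ofTower`, all by `rfl`), its `rhoB τ' = Representation.ofModule'` acts by
`MonoidAlgebra.of ℂ _ g • · = act g` (★ `ofModule'_apply_eq_of_smul`, ★ `TowerAlgebra.of_smul_eq_act`), and `clsHol` of `Theorems/H413CuspCotClassMap.lean`
is the map (`clsHol_injective`, `clsHol_rightRep`); the regime hypothesis `IsAnisotropic` holds because `6 ≤ [F:ℚ]` (★ `HermSpace3.isAnisotropic`).
`t2a_holClassMapAt` is the F0P4 planner's letter `StubT2aHolClassMapAt` (line of record, director s341) PROVED by its exact text (third clause: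
values in the `(1,0)`-part of the tower, `clsHol_mem_hodge10Part` — every component is a `compClass ∈ F¹`).  What is left of `stub_T2_matsushimaHodgeAt`: the `(0,1)` summand `conjFun '' holCotForms 𝔞₀` (a conjugate-linear involution on the tower compatible with
`ofLevel`/`act`, and `F¹ ∩ F̄¹ = 0`) — T2-PLAN memo G3.  HC_CM is proved only modulo the 7 printed citations until rung 0 closes.
[cite: Liu2021, proof of Prop. 4.13, l. 2145] [cite: BorelWallach2000, VII 3.2; XIII 1.2]

## References
* [Liu2021] Prop. 4.13 and its proof (l. 2145).  * [BorelWallach2000] VII 3.2, XIII 1.2.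
* Tree: `Theorems/H413CuspCotClassMap` (`clsHol`), `CorCM/Hyp413/A3Liu413FaceTypes` (`datum413`), HodgeCM `Model/TowerAlgebra` (`of_smul_eq_act`),
  `Literature/RepresentationTheory/Semisimple/EquivariantIrreducibleDecomposition` (`ofModule'_apply_eq_of_smul`).
-/

set_option autoImplicit false
set_option linter.dupNamespace false

noncomputable section

open MulAction NumberField NumberField.InfinitePlace
open HodgeCM HodgeCM.Model HodgeCM.Model.LiuIndex HodgeCM.Model.TowerCarrier
open Summit.HodgeConjecture.CorCM.Model
open Literature.AlgebraicGeometry.Motives (CMType)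
open Literature.AlgebraicGeometry.HodgeTheory Literature.NumberTheory.Automorphic.PicardCM
open Literature.AlgebraicGeometry.ShimuraVarieties Literature.AlgebraicGeometry.ShimuraVarieties.UnitaryCanonicalModel
open Literature.NumberTheory.ComplexMultiplication
open Literature.NumberTheory.Automorphic
open Literature.NumberTheory.Automorphic.Liu2021 Literature.NumberTheory.Automorphic.Liu2021.AppendixC
open Literature.NumberTheory.GelbartRogawski1991
open Summit.HodgeConjecture.CorCM Summit.HodgeConjecture.CorCM.Transposition
open Summit.HodgeConjecture.CorCM.Lines.A3Liu413 (datum413)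
open Summit.HodgeConjecture.HodgeConjecture.Cruxes.H413.CohFormsCarriers

namespace Summit.HodgeConjecture.HodgeConjecture.Cruxes.H413.CuspCot

set_option synthInstance.maxHeartbeats 400000 in
set_option maxHeartbeats 8000000 in
/-- **T2′, holomorphic half, AT THE PIN**: for every face and every `τ'` there is an INJECTIVE `ℂ`-linear class map from the holomorphic cotangent
automorphic forms of the factor of record into the pin's `H¹_{B,τ'}(A_∞, ℂ)`, intertwining `rightRep F V` with `rhoB τ'`.
[cite: Liu2021, proof of Prop. 4.13, l. 2145] [cite: BorelWallach2000, VII 3.2; XIII 1.2] -/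
theorem exists_holClassMap_pin
    (hDel : Literature.AlgebraicGeometry.ShimuraVarieties.UnitaryCanonicalModel.canonicalModel_exists_printed)
    (F : HodgeCM.CMField) [IsGalois ℚ F] (h6 : 6 ≤ Module.finrank ℚ F) {ι₁ : F →+* ℂ} (V : HodgeCM.HermSpace3 F ι₁) (a₀ : RealScalar F)
    (Φ : CMType F) (i : (I V (repAt a₀) (muLiu ι₁ GramClass.rep))) (τ' : HodgeCM.CMField.K F →+* ℂ) :
    ∃ cls : ↥(holCotForms (archFactorOf F V)) →ₗ[ℂ] (datum413 hDel F V a₀ Φ i).HB τ',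
      Function.Injective cls ∧
        ∀ (g : ↥(HodgeCM.HermSpace3.adelicFin V)) (f : ↥(holCotForms (archFactorOf F V)))
          (hgf : rightRep F V g (f : _) ∈ holCotForms (archFactorOf F V)),
          cls ⟨rightRep F V g (f : _), hgf⟩ = (datum413 hDel F V a₀ Φ i).rhoB τ' g (cls f) := by
  have h4 : 4 ≤ Module.finrank ℚ F := le_trans (by norm_num) h6
  have hV : IsAnisotropic F (HodgeCM.HermSpace3.Hm V) := HodgeCM.HermSpace3.isAnisotropic V h4
  refine ⟨clsHol exists_isReal_hodgeModel_holds hodgePQ_independent_of_hodgeModel_holds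
      Summit.HodgeConjecture.CorCM.BallQuotient.ballQuotientUniformised_holds
      (cmAbelianVarietyRealised_of_eigenbasis exists_isReal_hodgeModel_holds hodgePQ_independent_of_hodgeModel_holds
        Summit.HodgeConjecture.CorCM.cmAbelianVarietyEigenbasisRealised_holds)
      Literature.NumberTheory.Transcendental.arapura2012_cor_15_4_6_holds hV,
    clsHol_injective _ _ _ _ _ hV, fun g f hgf => ?_⟩
  have h1 := clsHol_rightRep exists_isReal_hodgeModel_holds hodgePQ_independent_of_hodgeModel_holds
      Summit.HodgeConjecture.CorCM.BallQuotient.ballQuotientUniformised_holds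
      (cmAbelianVarietyRealised_of_eigenbasis exists_isReal_hodgeModel_holds hodgePQ_independent_of_hodgeModel_holds
        Summit.HodgeConjecture.CorCM.cmAbelianVarietyEigenbasisRealised_holds)
      Literature.NumberTheory.Transcendental.arapura2012_cor_15_4_6_holds hV g f hgf
  -- the pin's `rhoB τ' = Representation.ofModule'` acts on the tower by `of g • · = act g`
  have h2 := (Literature.RepresentationTheory.Semisimple.ofModule'_apply_eq_of_smul (k := ℂ) (G := ↥(HodgeCM.HermSpace3.adelicFin V)) _ g
      (clsHol exists_isReal_hodgeModel_holds hodgePQ_independent_of_hodgeModel_holds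
        Summit.HodgeConjecture.CorCM.BallQuotient.ballQuotientUniformised_holds
        (cmAbelianVarietyRealised_of_eigenbasis exists_isReal_hodgeModel_holds hodgePQ_independent_of_hodgeModel_holds
          Summit.HodgeConjecture.CorCM.cmAbelianVarietyEigenbasisRealised_holds)
        Literature.NumberTheory.Transcendental.arapura2012_cor_15_4_6_holds hV f)).trans
    (of_smul_eq_act _ _ _ _ _ g _)
  exact h1.trans h2.symm

/-! ## The F0P4 planner's letter `StubT2aHolClassMapAt` (line of record `Lines/F0-P4AdmissibleOccursInH1.lean`, director s341): the same map, with
its values in the HODGE `(1,0)`-PART of the tower -/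

/-- Abbreviation-free restatement of the `(1,0)`-part of the pin's tower used by the planner's letter: the span over the tower index `TLvl V` of the
`ofLevel`-images of the level families all of whose components lie in `F¹`. -/
theorem clsHol_mem_hodge10Part
    (F : HodgeCM.CMField) {ι₁ : F →+* ℂ} (V : HodgeCM.HermSpace3 F ι₁) (hV : IsAnisotropic F (HodgeCM.HermSpace3.Hm V))
    (hHD : exists_isReal_hodgeModel) (hI : hodgePQ_independent_of_hodgeModel) (h₁ : BallQuotientUniformised) (h₃ : CMAbelianVarietyRealised)
    (hA : Literature.NumberTheory.Transcendental.Arapura2012_Cor_15_4_6) (f : ↥(holCotForms (archFactorOf F V))) :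
    clsHol hHD hI h₁ h₃ hA hV f ∈
      (⨆ j : HodgeCM.TLvl V,
        ((Submodule.pi Set.univ fun h : ↥(HodgeCM.HermSpace3.adelicFin V) =>
              ((HodgeCM.Model.universeOf hHD hI (ballQuotientUniformisedDatum_of h₁) h₃).hodge
                  ((HodgeCM.Model.universeOf hHD hI (ballQuotientUniformisedDatum_of h₁) h₃).pms F ι₁ V (j.1.conj h j.2)) 1).F 1).comap
            (HodgeCM.Model.TowerLevel.towerLevel hHD hI (ballQuotientUniformisedDatum_of h₁) h₃ hA j.1 j.2).subtype).map
          (HodgeCM.Model.TowerCarrier.ofLevel hHD hI (ballQuotientUniformisedDatum_of h₁) h₃ hA j.1 j.2) :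
        Submodule ℂ (Tower hHD hI (ballQuotientUniformisedDatum_of h₁) h₃ hA V)) := by
  refine Submodule.mem_iSup_of_mem ⟨levelOf f, belowConjThree_levelOf f⟩ (Submodule.mem_map.2 ⟨⟨_, towerFamily_mem hHD hI h₁ h₃ hA
    (belowConjThree_levelOf f) (toRegimeFun_mem_cuspCotSat_levelOf hV f)⟩, ?_, rfl⟩)
  rw [Submodule.mem_comap, Submodule.mem_pi]
  intro h _
  -- the component of index `h` is the component class `compClass … h ∈ (pinD …).H10 = F¹`
  exact (compClass hHD hI h₁ h₃ (belowConjThree_levelOf f) (toRegimeFun_mem_cuspCotSat_levelOf hV f) h).2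

set_option synthInstance.maxHeartbeats 400000 in
set_option maxHeartbeats 8000000 in
/-- **THE PLANNER'S LETTER T2a, PROVED** — `StubT2aHolClassMapAt` of the F0P4 line of record `Lines/F0-P4AdmissibleOccursInH1.lean` (director s341), by its
exact text: for every face (`3 ≤ n`) and every `τ'`, an INJECTIVE `U(V)(𝔸_{F⁺,f})`-EQUIVARIANT `ℂ`-linear class map `cls₁₀ : holCotForms 𝔞₀ → H¹_{B,τ'}(A_∞, ℂ)`
with values in the `(1,0)`-part of the tower.  `stub_T2a_holClassMapAt := CuspCot.t2a_holClassMapAt` closes it by `exact` once the line is registered.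
[cite: Liu2021, proof of Prop. 4.13, l. 2145] [cite: BorelWallach2000, VII 3.2; XIII 1.2] -/
theorem t2a_holClassMapAt :
    ∀ (hDel : Literature.AlgebraicGeometry.ShimuraVarieties.UnitaryCanonicalModel.canonicalModel_exists_printed)
      (F : HodgeCM.CMField) [IsGalois ℚ F] (h6 : 6 ≤ Module.finrank ℚ F) {ι₁ : F →+* ℂ} (V : HodgeCM.HermSpace3 F ι₁) (a₀ : RealScalar F)
      (Φ : CMType F) (hΦ : ι₁ ∈ Φ.1) (i : (I V (repAt a₀) (muLiu ι₁ GramClass.rep))),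
      3 ≤ (datum413 hDel F V a₀ Φ i).n → ∀ τ' : HodgeCM.CMField.K F →+* ℂ,
        ∃ cls₁₀ : ↥(holCotForms (archFactorOf F V)) →ₗ[ℂ] (datum413 hDel F V a₀ Φ i).HB τ',
          Function.Injective cls₁₀ ∧
            (∀ (g : ↥(HodgeCM.HermSpace3.adelicFin V)) (f : ↥(holCotForms (archFactorOf F V)))
                (hgf : rightRep F V g (f : _) ∈ holCotForms (archFactorOf F V)),
                cls₁₀ ⟨rightRep F V g (f : _), hgf⟩ = (datum413 hDel F V a₀ Φ i).rhoB τ' g (cls₁₀ f)) ∧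
            ∀ f : ↥(holCotForms (archFactorOf F V)), cls₁₀ f ∈
              (⨆ j : HodgeCM.TLvl V,
                ((Submodule.pi Set.univ fun h : ↥(HodgeCM.HermSpace3.adelicFin V) =>
                      ((HodgeCM.Model.universeOf exists_isReal_hodgeModel_holds hodgePQ_independent_of_hodgeModel_holds (ballQuotientUniformisedDatum_of Summit.HodgeConjecture.CorCM.BallQuotient.ballQuotientUniformised_holds) (cmAbelianVarietyRealised_of_eigenbasis exists_isReal_hodgeModel_holds hodgePQ_independent_of_hodgeModel_holds Summit.HodgeConjecture.CorCM.cmAbelianVarietyEigenbasisRealised_holds)).hodge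
                          ((HodgeCM.Model.universeOf exists_isReal_hodgeModel_holds hodgePQ_independent_of_hodgeModel_holds (ballQuotientUniformisedDatum_of Summit.HodgeConjecture.CorCM.BallQuotient.ballQuotientUniformised_holds) (cmAbelianVarietyRealised_of_eigenbasis exists_isReal_hodgeModel_holds hodgePQ_independent_of_hodgeModel_holds Summit.HodgeConjecture.CorCM.cmAbelianVarietyEigenbasisRealised_holds)).pms F ι₁ V (j.1.conj h j.2)) 1).F 1).comap
                    (HodgeCM.Model.TowerLevel.towerLevel exists_isReal_hodgeModel_holds hodgePQ_independent_of_hodgeModel_holds (ballQuotientUniformisedDatum_of Summit.HodgeConjecture.CorCM.BallQuotient.ballQuotientUniformised_holds) (cmAbelianVarietyRealised_of_eigenbasis exists_isReal_hodgeModel_holds hodgePQ_independent_of_hodgeModel_holds Summit.HodgeConjecture.CorCM.cmAbelianVarietyEigenbasisRealised_holds) Literature.NumberTheory.Transcendental.arapura2012_cor_15_4_6_holds j.1 j.2).subtype).map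
                  (HodgeCM.Model.TowerCarrier.ofLevel exists_isReal_hodgeModel_holds hodgePQ_independent_of_hodgeModel_holds (ballQuotientUniformisedDatum_of Summit.HodgeConjecture.CorCM.BallQuotient.ballQuotientUniformised_holds) (cmAbelianVarietyRealised_of_eigenbasis exists_isReal_hodgeModel_holds hodgePQ_independent_of_hodgeModel_holds Summit.HodgeConjecture.CorCM.cmAbelianVarietyEigenbasisRealised_holds) Literature.NumberTheory.Transcendental.arapura2012_cor_15_4_6_holds j.1 j.2) :
                Submodule ℂ ((datum413 hDel F V a₀ Φ i).HB τ')) := by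
  intro hDel F _ h6 ι₁ V a₀ Φ _ i _ τ'
  have h4 : 4 ≤ Module.finrank ℚ F := le_trans (by norm_num) h6
  have hV : IsAnisotropic F (HodgeCM.HermSpace3.Hm V) := HodgeCM.HermSpace3.isAnisotropic V h4
  refine ⟨clsHol exists_isReal_hodgeModel_holds hodgePQ_independent_of_hodgeModel_holds
      Summit.HodgeConjecture.CorCM.BallQuotient.ballQuotientUniformised_holds
      (cmAbelianVarietyRealised_of_eigenbasis exists_isReal_hodgeModel_holds hodgePQ_independent_of_hodgeModel_holds
        Summit.HodgeConjecture.CorCM.cmAbelianVarietyEigenbasisRealised_holds)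
      Literature.NumberTheory.Transcendental.arapura2012_cor_15_4_6_holds hV,
    clsHol_injective _ _ _ _ _ hV, fun g f hgf => ?_, fun f => ?_⟩
  · have h1 := clsHol_rightRep exists_isReal_hodgeModel_holds hodgePQ_independent_of_hodgeModel_holds
        Summit.HodgeConjecture.CorCM.BallQuotient.ballQuotientUniformised_holds
        (cmAbelianVarietyRealised_of_eigenbasis exists_isReal_hodgeModel_holds hodgePQ_independent_of_hodgeModel_holds
          Summit.HodgeConjecture.CorCM.cmAbelianVarietyEigenbasisRealised_holds)
        Literature.NumberTheory.Transcendental.arapura2012_cor_15_4_6_holds hV g f hgf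
    have h2 := (Literature.RepresentationTheory.Semisimple.ofModule'_apply_eq_of_smul (k := ℂ) (G := ↥(HodgeCM.HermSpace3.adelicFin V)) _ g
        (clsHol exists_isReal_hodgeModel_holds hodgePQ_independent_of_hodgeModel_holds
          Summit.HodgeConjecture.CorCM.BallQuotient.ballQuotientUniformised_holds
          (cmAbelianVarietyRealised_of_eigenbasis exists_isReal_hodgeModel_holds hodgePQ_independent_of_hodgeModel_holds
            Summit.HodgeConjecture.CorCM.cmAbelianVarietyEigenbasisRealised_holds)
          Literature.NumberTheory.Transcendental.arapura2012_cor_15_4_6_holds hV f)).trans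
      (of_smul_eq_act _ _ _ _ _ g _)
    exact h1.trans h2.symm
  · exact clsHol_mem_hodge10Part F V hV _ _ _ _ _ f

end Summit.HodgeConjecture.HodgeConjecture.Cruxes.H413.CuspCot

end
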